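import Summits.RiemannHypothesis.RiemannHypothesis.Theorems.HandoffLossyCoupling
import Summits.RiemannHypothesis.RiemannHypothesis.Theorems.HandoffHybridTarget
import HarnessLib

/-!
# The LOSSY tier of the handoff logic, II: increments with a loss (`HandoffStepLossy`) and their telescoping

Cell `rh-explicit`, TRACK «HANDOFF», seat handoff-theory-1 (definitions + logic), gen3.  Companion text:
`HOME/handoff/HANDOFF-STATEMENT.md` §J.3.  Builds on `HandoffLossyCoupling.lean` (this seat, gen3: near-positivity
tails, `WeilBottomBoundedCriterion`), `HandoffHybridTarget.lean` (gen2) and the tree's ground-energy API.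

HONEST FRAMING.  Nothing here is a step towards RH.  The increment `HandoffStep q` («positivity on `C((log q)/2)` ⟹
positivity on `C((log q⁺)/2)`») is VACUOUS in tail form (`exists_forall_handoffStep`).  The natural quantitative
repair is an increment WITH A LOSS that is demanded in the indefinite regime too:

  `StepLossy(q, δ)` : for every `ℓ ≥ 0`, `ε((log q)/2) ≥ −ℓ ⟹ ε((log q⁺)/2) ≥ −(ℓ + δ)`,

equivalently (`handoffStepLossy_iff`) `ε((log q⁺)/2) ≥ min(ε((log q)/2), 0) − δ` — a MODULUS OF DECREASE of the
window bottom `ε = weilGroundEnergy` across the window of `q`, i.e. the additive, prime-indexed discretisation of route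
`WeilWindowFlow`'s leakage laws (`Theses/WeilWindowFlow.lean`: `GronwallLeakage`, `WindowLipschitz`).  Status proved
here: RH-implied for every `δ ≥ 0` (`handoffStepLossy_of_riemannHypothesis`); at `δ = 0` it CONTAINS the increment
(`HandoffStepLossy.handoffStep`), so «certified rung at `q₀` ∧ `StepLossy(q, 0)` for all primes `q ≥ q₀`» is RH
(`riemannHypothesis_of_rung_and_forall_handoffStepLossy_zero`, via the hybrid target); it is NEITHER vacuous (it binds
the indefinite regime: all `ℓ`) NOR cumulative (it does not assert `ε((log q)/2) ≥ 0`); the losses TELESCOPE along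
consecutive primes (`neg_le_weilGroundEnergy_of_forall_handoffStepLossy`), so a summable (bounded-total) loss schedule
from a rung `q₀` on yields «`ε` bounded below on every window» (`neg_le_weilGroundEnergy_of_bounded_loss`) — and hence
RH GRANTED the open criterion `WeilBottomBoundedCriterion` of file I (`riemannHypothesis_of_bounded_loss`, CONDITIONAL).
What is NOT claimed: that any `StepLossy(q, δ_q)` with summable `δ` is provable by an RH-free mechanism — the trivial
modulus (operator norm of the atom `q` = `cap(q) = (log q)/√q`, plus the window-widening of the old form) is NOT
summable over the primes (HANDOFF-STATEMENT §J.3).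

References: Bombieri 2000 §4 Thm 5 (continuity/monotonicity of the bottom) [Bombieri2000Weil]; route
`RiemannHypothesis/WeilWindowFlow` (tree); this track HANDOFF-STATEMENT §B.3′, §I.4, §J.
-/

set_option linter.dupNamespace false  -- the mandated namespace repeats `RiemannHypothesis`

noncomputable section

open Set MeasureTheory Filter Literature.NumberTheory.LFunctions
open scoped Topology

namespace Summit.RiemannHypothesis.RiemannHypothesis.Theorems.HandoffDecomposition

variable {q : ℕ} {δ δ' : ℝ}

/-! ## §1  The lossy increment -/

/-- **`StepLossy(q, δ)`, the increment with loss `δ`**: for every `ℓ ≥ 0`, near-positivity with loss `ℓ` on the old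
cone `C((log q)/2)` implies near-positivity with loss `ℓ + δ` on the new cone `C((log q⁺)/2)` (`ε = weilGroundEnergy`,
the window bottom).  Quantified over ALL `ℓ ≥ 0`, so it also binds the (counterfactual under RH) indefinite regime —
this is what makes it non-vacuous in tail form; see `handoffStepLossy_iff`.  A statement of THIS track
(HANDOFF-STATEMENT.md §J.3), not a literature fact. [this track (theory-1 gen3), HANDOFF-STATEMENT.md §J.3] -/
def HandoffStepLossy (q : ℕ) (δ : ℝ) : Prop :=
  ∀ ℓ : ℝ, 0 ≤ ℓ → -ℓ ≤ weilGroundEnergy (Real.log q / 2) →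
    -(ℓ + δ) ≤ weilGroundEnergy (Real.log (nextPrime q) / 2)

/-- **RH-implied**: under RH every window bottom is `≥ 0`, so `StepLossy(q, δ)` holds for every `q` and every
`δ ≥ 0`. [cite: Bombieri2000Weil, Thm. 2; this track (theory-1 gen3)] -/
theorem handoffStepLossy_of_riemannHypothesis (hRH : Summit.RiemannHypothesis) (q : ℕ) (hδ : 0 ≤ δ) :
    HandoffStepLossy q δ := by
  intro ℓ hℓ _
  have ht : 0 < Real.log (nextPrime q) / 2 := by
    have := Real.log_pos (show (1 : ℝ) < nextPrime q by exact_mod_cast (nextPrime_prime q).one_lt)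
    positivity
  have h0 : 0 ≤ weilGroundEnergy (Real.log (nextPrime q) / 2) :=
    (weilGroundEnergy_nonneg_iff_holds ht).2 (MotivicDoor.Rungs.rung_R0.1 hRH _ ht)
  linarith

/-- Monotonicity in the loss. [this track (theory-1 gen3)] -/
theorem HandoffStepLossy.mono (h : HandoffStepLossy q δ) (hδ : δ ≤ δ') : HandoffStepLossy q δ' :=
  fun ℓ hℓ hold ↦ by have := h ℓ hℓ hold; linarith

/-- **What the lossy increment says**: `StepLossy(q, δ) ↔ ε((log q⁺)/2) ≥ min(ε((log q)/2), 0) − δ` — a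
one-sided MODULUS OF DECREASE of the window bottom across the window of `q` (in the indefinite regime: «negativity
grows by at most `δ`»; in the definite regime: «the new bottom is `≥ −δ`»). [this track (theory-1 gen3)] -/
theorem handoffStepLossy_iff (q : ℕ) (δ : ℝ) :
    HandoffStepLossy q δ ↔
      min (weilGroundEnergy (Real.log q / 2)) 0 - δ ≤ weilGroundEnergy (Real.log (nextPrime q) / 2) := by
  constructor
  · intro h
    rcases le_or_gt 0 (weilGroundEnergy (Real.log q / 2)) with h0 | hneg
    · have := h 0 le_rfl (by simpa using h0)
      rw [min_eq_right h0]
      linarith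
    · have := h (-weilGroundEnergy (Real.log q / 2)) (by linarith) (by simp)
      rw [min_eq_left hneg.le]
      linarith
  · intro h ℓ hℓ hold
    have hmin : -ℓ ≤ min (weilGroundEnergy (Real.log q / 2)) 0 := le_min hold (by linarith)
    linarith

/-- **At zero loss the lossy increment CONTAINS the increment**: `StepLossy(q, 0) → HandoffStep q` (`q` prime).
[this track (theory-1 gen3)] -/
theorem HandoffStepLossy.handoffStep (hq : q.Prime) (h : HandoffStepLossy q 0) : HandoffStep q := by
  intro hIH
  have hpos : 0 < Real.log q / 2 := by
    have := Real.log_pos (show (1 : ℝ) < q by exact_mod_cast hq.one_lt); positivity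
  have hpos' : 0 < Real.log (nextPrime q) / 2 := by
    have := Real.log_pos (show (1 : ℝ) < nextPrime q by exact_mod_cast (nextPrime_prime q).one_lt); positivity
  have h0 : 0 ≤ weilGroundEnergy (Real.log q / 2) := (weilGroundEnergy_nonneg_iff_holds hpos).2 hIH
  have h1 := h 0 le_rfl (by simpa using h0)
  rw [handoffH_iff_weilPositivityOn hq]
  exact (weilGroundEnergy_nonneg_iff_holds hpos').1 (by simpa using h1)

/-- **Hybrid target with the lossless lossy increment**: a (certified) rung `WeilPositivityOn((log q₀)/2)` at a prime
`q₀` and `StepLossy(q, 0)` for all primes `q ≥ q₀` give RH (`riemannHypothesis_iff_rung_and_forall_ge_handoffStep`).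
[this track (theory-1 gen3); Bombieri2000Weil Thm. 2] -/
theorem riemannHypothesis_of_rung_and_forall_handoffStepLossy_zero {q₀ : ℕ} (hq₀ : q₀.Prime)
    (hr : WeilPositivityOn (Real.log q₀ / 2)) (h : ∀ q : ℕ, q.Prime → q₀ ≤ q → HandoffStepLossy q 0) :
    Summit.RiemannHypothesis :=
  (riemannHypothesis_iff_rung_and_forall_ge_handoffStep hq₀).2 ⟨hr, fun q hq hle ↦ (h q hq hle).handoffStep hq⟩

/-- `RH ↔ ∀ q prime, StepLossy(q, 0)` (the base rung `(log 2)/2` is Yoshida's theorem). [this track (theory-1 gen3)] -/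
theorem riemannHypothesis_iff_forall_handoffStepLossy_zero :
    Summit.RiemannHypothesis ↔ ∀ q : ℕ, q.Prime → HandoffStepLossy q 0 :=
  ⟨fun h q _ ↦ handoffStepLossy_of_riemannHypothesis h q le_rfl, fun h ↦
    riemannHypothesis_of_rung_and_forall_handoffStepLossy_zero Nat.prime_two handoffBase_holds
      fun q hq _ ↦ h q hq⟩

/-! ## §2  Telescoping the losses along consecutive primes -/

/-- The primes in `[q, Q)` for consecutive primes `q < Q` are just `{q}`. [folklore] -/
theorem filter_prime_Ico_eq_singleton_of_consecutivePrimes {q Q : ℕ} (h : Handoff.ConsecutivePrimes q Q) :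
    (Finset.Ico q Q).filter Nat.Prime = {q} := by
  ext p
  simp only [Finset.mem_filter, Finset.mem_Ico, Finset.mem_singleton]
  constructor
  · rintro ⟨⟨hqp, hpQ⟩, hp⟩
    by_contra hne
    exact absurd (h.2.2.2 p hp (lt_of_le_of_ne hqp (Ne.symm hne))) (not_le.2 hpQ)
  · rintro rfl
    exact ⟨⟨le_rfl, h.2.2.1⟩, h.1⟩

/-- Splitting the loss sum at the previous prime: for consecutive primes `q < Q` and `q₀ ≤ q`,
`Σ_{p prime, q₀ ≤ p < Q} δ p = Σ_{p prime, q₀ ≤ p < q} δ p + δ q`. [folklore] -/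
theorem sum_filter_prime_Ico_of_consecutivePrimes {q₀ q Q : ℕ} (δ : ℕ → ℝ) (h : Handoff.ConsecutivePrimes q Q)
    (hq₀ : q₀ ≤ q) :
    ∑ p ∈ (Finset.Ico q₀ Q).filter Nat.Prime, δ p = (∑ p ∈ (Finset.Ico q₀ q).filter Nat.Prime, δ p) + δ q := by
  rw [← Finset.Ico_union_Ico_eq_Ico hq₀ h.2.2.1.le, Finset.filter_union,
    Finset.sum_union (Finset.disjoint_filter_filter (Finset.Ico_disjoint_Ico_consecutive q₀ q Q)),
    filter_prime_Ico_eq_singleton_of_consecutivePrimes h, Finset.sum_singleton]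

/-- **TELESCOPING**: from a rung with loss `ℓ₀ ≥ 0` at a prime `q₀` (`ε((log q₀)/2) ≥ −ℓ₀`) and lossy increments
`StepLossy(q, δ_q)` (`δ ≥ 0`) at all primes `q ≥ q₀`, every prime `Q ≥ q₀` has
`ε((log Q)/2) ≥ −(ℓ₀ + Σ_{p prime, q₀ ≤ p < Q} δ_p)`.  (Strong induction along consecutive primes.) [this track (theory-1 gen3)] -/
theorem neg_le_weilGroundEnergy_of_forall_handoffStepLossy {δ : ℕ → ℝ} {q₀ : ℕ} {ℓ₀ : ℝ} (hq₀ : q₀.Prime)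
    (hℓ₀ : 0 ≤ ℓ₀) (hδ : ∀ q : ℕ, q.Prime → 0 ≤ δ q) (hr : -ℓ₀ ≤ weilGroundEnergy (Real.log q₀ / 2))
    (h : ∀ q : ℕ, q.Prime → q₀ ≤ q → HandoffStepLossy q (δ q)) {Q : ℕ} (hQ : Q.Prime) (hle : q₀ ≤ Q) :
    -(ℓ₀ + ∑ p ∈ (Finset.Ico q₀ Q).filter Nat.Prime, δ p) ≤ weilGroundEnergy (Real.log Q / 2) := by
  induction Q using Nat.strong_induction_on with
  | _ Q IH =>
    rcases hle.eq_or_lt with rfl | hlt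
    · simpa using hr
    · -- the previous prime `q` of `Q` is `≥ q₀`
      have h3 : 3 ≤ Q := by have := hq₀.two_le; omega
      obtain ⟨q, hcons⟩ := Handoff.exists_consecutivePrimes_of_prime hQ h3
      have hq₀q : q₀ ≤ q := by
        by_contra hlt'
        exact absurd (hcons.2.2.2 q₀ hq₀ (not_le.1 hlt')) (not_le.2 hlt)
      have hIH := IH q hcons.2.2.1 hcons.1 hq₀q
      have hsum_nonneg : 0 ≤ ∑ p ∈ (Finset.Ico q₀ q).filter Nat.Prime, δ p :=
        Finset.sum_nonneg fun p hp ↦ hδ p (Finset.mem_filter.1 hp).2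
      have hstep := h q hcons.1 hq₀q (ℓ₀ + ∑ p ∈ (Finset.Ico q₀ q).filter Nat.Prime, δ p) (by positivity) hIH
      rw [nextPrime_eq_of_consecutivePrimes hcons] at hstep
      rw [sum_filter_prime_Ico_of_consecutivePrimes δ hcons hq₀q]
      convert hstep using 1
      ring

/-- **BOUNDED TOTAL LOSS ⟹ THE BOTTOM IS BOUNDED BELOW ON EVERY WINDOW**: if moreover the partial loss sums from
`q₀` are `≤ D`, then `ε(t) ≥ −(ℓ₀ + D)` for every window `t > 0` (every window lies below some prime `Q ≥ q₀`; `ε` is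
antitone). [this track (theory-1 gen3); Bombieri2000Weil §4 Thm. 5] -/
theorem neg_le_weilGroundEnergy_of_bounded_loss {δ : ℕ → ℝ} {q₀ : ℕ} {ℓ₀ D : ℝ} (hq₀ : q₀.Prime)
    (hℓ₀ : 0 ≤ ℓ₀) (hδ : ∀ q : ℕ, q.Prime → 0 ≤ δ q) (hr : -ℓ₀ ≤ weilGroundEnergy (Real.log q₀ / 2))
    (h : ∀ q : ℕ, q.Prime → q₀ ≤ q → HandoffStepLossy q (δ q))
    (hD : ∀ Q : ℕ, ∑ p ∈ (Finset.Ico q₀ Q).filter Nat.Prime, δ p ≤ D) {t : ℝ} (ht : 0 < t) :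
    -(ℓ₀ + D) ≤ weilGroundEnergy t := by
  obtain ⟨Q, hQ, hQp⟩ := Nat.exists_infinite_primes (max q₀ (⌈Real.exp (2 * t)⌉₊ + 1))
  have h1 := neg_le_weilGroundEnergy_of_forall_handoffStepLossy hq₀ hℓ₀ hδ hr h hQp ((le_max_left _ _).trans hQ)
  have h2 := weilGroundEnergy_anti ht (le_log_half_of_ceil_exp_lt ((le_max_right _ _).trans hQ))
  have h3 := hD Q
  linarith

/-- **CONDITIONAL HEADLINE**: GRANTED the open criterion `WeilBottomBoundedCriterion` («`ε` bounded below ⟹ RH»,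
file I), a rung with loss at a prime `q₀` and lossy increments with BOUNDED TOTAL LOSS from `q₀` on imply RH — the
first RH-yielding handoff target of this track with genuine slack in every step (the slack must be summable over the
primes).  Unconditional special case `δ = 0`, `ℓ₀ = 0`: `riemannHypothesis_of_rung_and_forall_handoffStepLossy_zero`.
[this track (theory-1 gen3) — conditional on the OPEN criterion] -/
theorem riemannHypothesis_of_bounded_loss (hL : WeilBottomBoundedCriterion) {δ : ℕ → ℝ} {q₀ : ℕ} {ℓ₀ D : ℝ}
    (hq₀ : q₀.Prime) (hℓ₀ : 0 ≤ ℓ₀) (hδ : ∀ q : ℕ, q.Prime → 0 ≤ δ q)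
    (hr : -ℓ₀ ≤ weilGroundEnergy (Real.log q₀ / 2)) (h : ∀ q : ℕ, q.Prime → q₀ ≤ q → HandoffStepLossy q (δ q))
    (hD : ∀ Q : ℕ, ∑ p ∈ (Finset.Ico q₀ Q).filter Nat.Prime, δ p ≤ D) : Summit.RiemannHypothesis :=
  hL ⟨ℓ₀ + D, fun _ ht ↦ neg_le_weilGroundEnergy_of_bounded_loss hq₀ hℓ₀ hδ hr h hD ht⟩

/-- **The regularised coupling law gives a lossy increment for free** — in fact without using its hypothesis:
`CouplingReg(q, q⁺, η, ℓ)` (`q` prime, `0 < η < (log q)/2`, `ℓ ≥ 0`) gives `ε((log q⁺)/2) ≥ −ℓ` outright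
(`neg_le_weilGroundEnergy_new_of_handoffCouplingReg`), hence `StepLossy(q, ℓ)`. [this track (theory-1 gen3)] -/
theorem handoffStepLossy_of_handoffCouplingReg (hq : q.Prime) {η ℓ : ℝ} (hη : 0 < η) (hη' : η < Real.log q / 2)
    (hℓ : 0 ≤ ℓ) (hC : HandoffCouplingReg q (nextPrime q) η ℓ) : HandoffStepLossy q ℓ := by
  intro ℓ' hℓ' _
  have := neg_le_weilGroundEnergy_new_of_handoffCouplingReg hq.two_le (lt_nextPrime q) hη hη' hℓ hC
  linarith

end Summit.RiemannHypothesis.RiemannHypothesis.Theorems.HandoffDecomposition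

end
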